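import Literature.Geometry.Kaehler.ComplexTorusSimpleLefschetzLieAlgebraSemisimple
import Literature.Geometry.Kaehler.ComplexTorusAlbertTypeIIAndIIILefschetzLieAlgebraDimension
import Literature.Geometry.Kaehler.ComplexTorusLefschetzGroupConnectedNoTypeIII
import Literature.Geometry.Kaehler.ComplexTorusAlbertTypeIIIShimura
import HarnessLib

/-!
# Milne's Summary table of the groups `S(A)` (Duke Math. J. 96 (1999), p. 652) at torus level, ASSEMBLED: for a simple
# polarised complex torus of Albert type I ∕ II ∕ III ∕ IV the three columns «Dimension», «Semisimple», «Connected» in one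
# statement per row, and the whole table unconditionally for `g ≤ 7`

Layer `Literature/Geometry/Kaehler`, namespace `Literature.Geometry.Kaehler.ComplexTorus`; lane `lit-hodgefound` (Track 2
foundations library); prover seat `lit-hodgefound-p17`, generation 60, self-proposed row g60-#2 — the CAPSTONE of the seat's
generations 58–60 (FREE POINTER 2 of generation 59, widened from the «Dimension» column to the whole table).  THEOREMS ONLY
(no definition, no instance, no notation, no named fact; D-0026 net debt `0`); every cell is a tree theorem consumed BY NAME:

| row | «Dimension» (as an identity over `ℕ`) | «Semisimple» | «Connected» |
|---|---|---|---|
| I | `e·dim Lie S = 2g² + eg` (✔ g59-#2 `IsSimple.finrank_mul_finrank_lefschetzLieRat_eq_of_isAlbertTypeI`) | Yes (✔ g60-#1) | Yes (p29 `…of_isAlbertTypeI`) |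
| II | `2e·dim Lie S = g² + eg` (✔ g59-#5) | Yes (✔ g60-#1) | Yes (p29 `…of_isAlbertTypeII`) |
| III | `2e·dim Lie S + eg = g²` (✔ g59-#5), with `4e ≤ g` (p12 `ComplexTorusAlbertTypeIIIShimura`) | Yes (✔ g60-#1) | No (p29 `IsSimple.lefschetzIdentityC_lt_lefschetzGroupC_of_isAlbertTypeIII`) |
| IV | `[End_ℚ(X):ℚ]·dim Lie S = 2g²` (✔ g59-#6) | No (✔ g59-#6 §4) | Yes (p05 `…of_isAlbertTypeIV`) |

Here `e = f = [K : ℚ]` is the degree of the centre `K` of `End_ℚ(X)` (Milne's `f = [F : ℚ]`, `F` the Rosati-fixed subfield of `K`,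
equals `e` in rows I–III; in row IV `[End_ℚ(X) : ℚ] = 2fd²` and the printed `g²/(d²f)` is `2g²/[End_ℚ(X):ℚ]`), `dim Lie S` is
`dim_ℚ` of Milne's `ℚ`-Lie algebra `Lie S(X) = lefschetzLieRat Ψ G` (`= dim S(A)`), «Semisimple» is `LieAlgebra.IsSemisimple ℚ (Lie S(X))`
and «Connected» is `S(X)(ℂ)⁰ = S(X)(ℂ)`, i.e. Lange's identity component `Lf(X)(ℂ) = lefschetzIdentityC Ψ G` equals Milne's
`S(X)(ℂ) = lefschetzGroupC Ψ G`.

## Source, VERBATIM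

J. S. Milne [Milne1999LefschetzClasses], *Lefschetz classes on abelian varieties*, Duke Math. J. **96** (1999) 639–675 (held
`paper:doi-10-1215-s0012-7094-99-09620-5`), end of §2, p. 652 (p0014 L5–L12): «Summary. The following table summarizes the
properties of the reductive groups `S(A)`.  Type ∣ Group ∣ Semisimple ∣ Connected ∣ Dimension ∣ Rank — I ∣ `Sp_{2g/f}` ∣ Yes ∣ Yes ∣
`2g²/f + g` ∣ `g` — II ∣ `Sp_{g/f}` ∣ Yes ∣ Yes ∣ `g²/2f + g/2` ∣ `g/2` — III ∣ `O_{g/f}` ∣ Yes ∣ No ∣ `g²/2f − g/2` ∣ … — IV ∣ `GL_{g/(df)}` ∣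
No ∣ Yes ∣ `g²/(d²f)` ∣ `g/d`», with (p0013–p0014) «The group `S(A)_{/k^al}` is isomorphic to `f` copies of the group listed in the
second column».  The Albert types are Lange's [Lange2023AbelianVarietiesComplex] §2.6.1 Proposition ∕ Thm. 2.6.5 ∕ Thm. 2.6.8
(tree: `IsAlbertTypeI … IV` of `RingTheory/CentralSimple/AlbertTypes`, over the centre `centerField` with the Rosati involution
`rosatiEnd`), and for `g ≤ 7` every simple polarised torus is of one of the four types (tree: `IsSimple.isAlbertType_of_finrank_le_seven`,
Albert's theorem with Step I by counting).

## What is proved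

* §1 one theorem per row: **`IsSimple.milneSummaryTable_of_isAlbertTypeI ∕ II ∕ III ∕ IV`** — the conjunction «Dimension ∧
  Semisimple ∧ Connected» of the row (row III: `… ∧ Lf(X)(ℂ) < S(X)(ℂ) ∧ 4e ≤ g`; row IV: `… ∧ ¬ semisimple ∧ …`).
* §2 the two Boolean columns as EQUIVALENCES valid for every simple polarised torus of any type:
  `IsSimple.isSemisimple_lefschetzLieRat_and_lefschetzIdentityC_eq_iff` («Semisimple ∧ Connected» ⟺ type neither III nor IV,
  under the tetrachotomy), and **`IsSimple.milneSummaryTable_of_isAlbertType`** (the four-row disjunction from the tetrachotomy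
  hypothesis).
* §3 **`IsSimple.milneSummaryTable_of_finrank_le_seven`** — the whole table, unconditionally, for every simple polarised complex
  torus of dimension `g ≤ 7`; and the two columns read backwards for `g ≤ 7`: `IsSimple.not_isSemisimple_lefschetzLieRat_iff_isAlbertTypeIV_of_finrank_le_seven`,
  `IsSimple.lefschetzIdentityC_ne_lefschetzGroupC_iff_isAlbertTypeIII_of_finrank_le_seven`.

NOT here: the «Group» column as an isomorphism type over `k^al` (`Sp`, `O`, `GL` and «`f` copies»), the «Rank» column, and the
tetrachotomy for `g ≥ 8` (Step I of Lange's Thm. 2.6.5 needs period = index in `Br(K)`; tree `-- TODO(general form)` in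
`ComplexTorusAlbertClassificationLowDimension`).
-/

noncomputable section

open scoped Matrix
open Module Matrix Complex Function NumberField
open Literature.RingTheory.CentralSimple (IsAlbertTypeI IsAlbertTypeII IsAlbertTypeIII IsAlbertTypeIV)

namespace Literature.Geometry.Kaehler

namespace ComplexTorus

section SummaryTable

variable {κ : Type} [Fintype κ] [DecidableEq κ] [Nonempty κ] {E : Type} [NormedAddCommGroup E] [NormedSpace ℂ E]
  [FiniteDimensional ℂ E] {Ψ : (κ → ℝ) ≃L[ℝ] E} {η : E [⋀^Fin 2]→L[ℝ] ℝ} {G : Matrix κ κ ℚ}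

/-! ## §1 One theorem per row -/

/-- **ROW I: «I ∣ `Sp_{2g/f}` ∣ Semisimple: Yes ∣ Connected: Yes ∣ Dimension `2g²/f + g`»** — for a simple polarised complex torus of
Albert type I with centre degree `e = f`: `e · dim_ℚ Lie S(X) = 2g² + ge`, `Lie S(X)` is semisimple over `ℚ`, and `Lf(X)(ℂ) = S(X)(ℂ)`.
[cite: Milne1999LefschetzClasses, §2 Summary table p. 652 (row I) and §2 «Simple abelian variety of type I» (p. 648)]
[cite: Lange2023AbelianVarietiesComplex, §2.6.2 Thm. 2.6.5 (a)] -/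
theorem IsSimple.milneSummaryTable_of_isAlbertTypeI (hX : IsSimple Ψ) (hη : IsRiemannForm Ψ η)
    (hG : G.map (Rat.cast : ℚ → ℝ) = latticeGram Ψ η) (h : IsAlbertTypeI (centerField Ψ hX) (endAlgRat Ψ) (rosatiEnd Ψ hη.1 hη.2.2 hG)) :
    finrank ℚ (centerField Ψ hX) * finrank ℚ (lefschetzLieRat Ψ G) = 2 * finrank ℂ E ^ 2 + finrank ℚ (centerField Ψ hX) * finrank ℂ E ∧
      LieAlgebra.IsSemisimple ℚ ↥(lefschetzLieRat Ψ G) ∧ lefschetzIdentityC Ψ G = lefschetzGroupC Ψ G :=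
  ⟨hX.finrank_mul_finrank_lefschetzLieRat_eq_of_isAlbertTypeI hη hG h, hX.isSemisimple_lefschetzLieRat_of_isAlbertTypeI hη hG h,
    hX.lefschetzIdentityC_eq_lefschetzGroupC_of_isAlbertTypeI hη hG h⟩

/-- **ROW II: «II ∣ `Sp_{g/f}` ∣ Semisimple: Yes ∣ Connected: Yes ∣ Dimension `g²/2f + g/2`»** — Albert type II, `e = f`:
`2e · dim_ℚ Lie S(X) = g² + ge`, `Lie S(X)` semisimple, `Lf(X)(ℂ) = S(X)(ℂ)`.
[cite: Milne1999LefschetzClasses, §2 Summary table p. 652 (row II) and §2 «Simple abelian variety of type II» (p. 649–650)]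
[cite: Lange2023AbelianVarietiesComplex, §2.6.2 Thm. 2.6.5 (b)] -/
theorem IsSimple.milneSummaryTable_of_isAlbertTypeII (hX : IsSimple Ψ) (hη : IsRiemannForm Ψ η)
    (hG : G.map (Rat.cast : ℚ → ℝ) = latticeGram Ψ η) (h : IsAlbertTypeII (centerField Ψ hX) (endAlgRat Ψ) (rosatiEnd Ψ hη.1 hη.2.2 hG)) :
    2 * (finrank ℚ (centerField Ψ hX) * finrank ℚ (lefschetzLieRat Ψ G)) = finrank ℂ E ^ 2 + finrank ℚ (centerField Ψ hX) * finrank ℂ E ∧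
      LieAlgebra.IsSemisimple ℚ ↥(lefschetzLieRat Ψ G) ∧ lefschetzIdentityC Ψ G = lefschetzGroupC Ψ G :=
  ⟨hX.two_mul_finrank_mul_finrank_lefschetzLieRat_eq_of_isAlbertTypeII hη hG h, hX.isSemisimple_lefschetzLieRat_of_isAlbertTypeII hη hG h,
    hX.lefschetzIdentityC_eq_lefschetzGroupC_of_isAlbertTypeII hη hG h⟩

/-- **ROW III: «III ∣ `O_{g/f}` ∣ Semisimple: Yes ∣ Connected: No ∣ Dimension `g²/2f − g/2`»** — Albert type III, `e = f`:
`2e · dim_ℚ Lie S(X) + ge = g²`, `Lie S(X)` semisimple, `Lf(X)(ℂ) = S(X)(ℂ)⁰ ⊊ S(X)(ℂ)`, and `4e ≤ g` (`g/f ≥ 4`: Shimura's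
exceptional case `m = 1` does not occur, so `O_{g/f}` is never `O₂`). [cite: Milne1999LefschetzClasses, §2 Summary table p. 652 (row III), «type III» (p. 650–651) and Remark 4.9]
[cite: Lange2023AbelianVarietiesComplex, §2.6.2 Thm. 2.6.5 (c)] [cite: HulekLaface2019PicardNumbersAV, §5.1 Prop. 5.1, exceptional case (1)] -/
theorem IsSimple.milneSummaryTable_of_isAlbertTypeIII (hX : IsSimple Ψ) (hη : IsRiemannForm Ψ η)
    (hG : G.map (Rat.cast : ℚ → ℝ) = latticeGram Ψ η) (h : IsAlbertTypeIII (centerField Ψ hX) (endAlgRat Ψ) (rosatiEnd Ψ hη.1 hη.2.2 hG)) :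
    2 * (finrank ℚ (centerField Ψ hX) * finrank ℚ (lefschetzLieRat Ψ G)) + finrank ℚ (centerField Ψ hX) * finrank ℂ E = finrank ℂ E ^ 2 ∧
      LieAlgebra.IsSemisimple ℚ ↥(lefschetzLieRat Ψ G) ∧ lefschetzIdentityC Ψ G < lefschetzGroupC Ψ G ∧
      4 * finrank ℚ (centerField Ψ hX) ≤ finrank ℂ E :=
  ⟨hX.two_mul_finrank_mul_finrank_lefschetzLieRat_add_eq_of_isAlbertTypeIII hη hG h, hX.isSemisimple_lefschetzLieRat_of_isAlbertTypeIII hη hG h,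
    hX.lefschetzIdentityC_lt_lefschetzGroupC_of_isAlbertTypeIII hη hG h, hX.four_mul_finrank_centerField_le_of_isAlbertTypeIII hη hG h⟩

/-- **ROW IV: «IV ∣ `GL_{g/(df)}` ∣ Semisimple: No ∣ Connected: Yes ∣ Dimension `g²/(d²f)`»** — Albert type IV (`[End_ℚ(X):ℚ] = 2fd²`):
`[End_ℚ(X) : ℚ] · dim_ℚ Lie S(X) = 2g²`, `Lie S(X)` is NOT semisimple (non-zero centre `K⁻`), and `Lf(X)(ℂ) = S(X)(ℂ)`.
[cite: Milne1999LefschetzClasses, §2 Summary table p. 652 (row IV) and «Simple abelian variety of type IV» (p. 651)]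
[cite: Lange2023AbelianVarietiesComplex, §2.6.1 Proposition (table, line 4) and Thm. 2.6.8] -/
theorem IsSimple.milneSummaryTable_of_isAlbertTypeIV (hX : IsSimple Ψ) (hη : IsRiemannForm Ψ η)
    (hG : G.map (Rat.cast : ℚ → ℝ) = latticeGram Ψ η) (h : IsAlbertTypeIV (centerField Ψ hX) (endAlgRat Ψ) (rosatiEnd Ψ hη.1 hη.2.2 hG)) :
    finrank ℚ (endAlgRat Ψ) * finrank ℚ (lefschetzLieRat Ψ G) = 2 * finrank ℂ E ^ 2 ∧
      ¬ LieAlgebra.IsSemisimple ℚ ↥(lefschetzLieRat Ψ G) ∧ lefschetzIdentityC Ψ G = lefschetzGroupC Ψ G :=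
  ⟨hX.finrank_endAlgRat_mul_finrank_lefschetzLieRat_eq_of_isAlbertTypeIV hη hG h, hX.not_isSemisimple_lefschetzLieRat_of_isAlbertTypeIV hη hG h,
    hX.lefschetzIdentityC_eq_lefschetzGroupC_of_isAlbertTypeIV hη hG h⟩

/-! ## §2 The two Boolean columns, for every simple polarised torus sorted into a type -/

/-- **«Semisimple» and «Connected» together: `Lie S(X)` semisimple AND `S(X)(ℂ)` connected iff `X` is of type neither IV nor III**
(the column «Semisimple» fails exactly in row IV — ✔ g60-#1, every `g` — and «Connected» exactly in row III), for a simple polarised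
torus of one of the four Albert types. [cite: Milne1999LefschetzClasses, §2 Summary table p. 652 (columns «Semisimple», «Connected») and Remark 4.9] -/
theorem IsSimple.isSemisimple_lefschetzLieRat_and_lefschetzIdentityC_eq_iff (hX : IsSimple Ψ) (hη : IsRiemannForm Ψ η)
    (hG : G.map (Rat.cast : ℚ → ℝ) = latticeGram Ψ η)
    (h : IsAlbertTypeI (centerField Ψ hX) (endAlgRat Ψ) (rosatiEnd Ψ hη.1 hη.2.2 hG) ∨
      IsAlbertTypeII (centerField Ψ hX) (endAlgRat Ψ) (rosatiEnd Ψ hη.1 hη.2.2 hG) ∨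
        IsAlbertTypeIII (centerField Ψ hX) (endAlgRat Ψ) (rosatiEnd Ψ hη.1 hη.2.2 hG) ∨
          IsAlbertTypeIV (centerField Ψ hX) (endAlgRat Ψ) (rosatiEnd Ψ hη.1 hη.2.2 hG)) :
    (LieAlgebra.IsSemisimple ℚ ↥(lefschetzLieRat Ψ G) ∧ lefschetzIdentityC Ψ G = lefschetzGroupC Ψ G) ↔
      ¬ IsAlbertTypeIV (centerField Ψ hX) (endAlgRat Ψ) (rosatiEnd Ψ hη.1 hη.2.2 hG) ∧
        ¬ IsAlbertTypeIII (centerField Ψ hX) (endAlgRat Ψ) (rosatiEnd Ψ hη.1 hη.2.2 hG) := by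
  rw [hX.isSemisimple_lefschetzLieRat_iff_not_isAlbertTypeIV hη hG,
    hX.lefschetzIdentityC_eq_lefschetzGroupC_iff_not_isAlbertTypeIII_of_isAlbertType hη hG h]

/-- **THE SUMMARY TABLE UNDER THE TETRACHOTOMY**: a simple polarised complex torus of Albert type I, II, III or IV satisfies the
corresponding row (Dimension ∧ Semisimple ∧ Connected). [cite: Milne1999LefschetzClasses, §2 Summary table p. 652]
[cite: Lange2023AbelianVarietiesComplex, §2.6.1 Proposition, Thm. 2.6.5 and Thm. 2.6.8] -/
theorem IsSimple.milneSummaryTable_of_isAlbertType (hX : IsSimple Ψ) (hη : IsRiemannForm Ψ η)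
    (hG : G.map (Rat.cast : ℚ → ℝ) = latticeGram Ψ η)
    (h : IsAlbertTypeI (centerField Ψ hX) (endAlgRat Ψ) (rosatiEnd Ψ hη.1 hη.2.2 hG) ∨
      IsAlbertTypeII (centerField Ψ hX) (endAlgRat Ψ) (rosatiEnd Ψ hη.1 hη.2.2 hG) ∨
        IsAlbertTypeIII (centerField Ψ hX) (endAlgRat Ψ) (rosatiEnd Ψ hη.1 hη.2.2 hG) ∨
          IsAlbertTypeIV (centerField Ψ hX) (endAlgRat Ψ) (rosatiEnd Ψ hη.1 hη.2.2 hG)) :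
    (IsAlbertTypeI (centerField Ψ hX) (endAlgRat Ψ) (rosatiEnd Ψ hη.1 hη.2.2 hG) ∧
        finrank ℚ (centerField Ψ hX) * finrank ℚ (lefschetzLieRat Ψ G) = 2 * finrank ℂ E ^ 2 + finrank ℚ (centerField Ψ hX) * finrank ℂ E ∧
        LieAlgebra.IsSemisimple ℚ ↥(lefschetzLieRat Ψ G) ∧ lefschetzIdentityC Ψ G = lefschetzGroupC Ψ G) ∨
      (IsAlbertTypeII (centerField Ψ hX) (endAlgRat Ψ) (rosatiEnd Ψ hη.1 hη.2.2 hG) ∧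
        2 * (finrank ℚ (centerField Ψ hX) * finrank ℚ (lefschetzLieRat Ψ G)) = finrank ℂ E ^ 2 + finrank ℚ (centerField Ψ hX) * finrank ℂ E ∧
        LieAlgebra.IsSemisimple ℚ ↥(lefschetzLieRat Ψ G) ∧ lefschetzIdentityC Ψ G = lefschetzGroupC Ψ G) ∨
      (IsAlbertTypeIII (centerField Ψ hX) (endAlgRat Ψ) (rosatiEnd Ψ hη.1 hη.2.2 hG) ∧
        2 * (finrank ℚ (centerField Ψ hX) * finrank ℚ (lefschetzLieRat Ψ G)) + finrank ℚ (centerField Ψ hX) * finrank ℂ E = finrank ℂ E ^ 2 ∧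
        LieAlgebra.IsSemisimple ℚ ↥(lefschetzLieRat Ψ G) ∧ lefschetzIdentityC Ψ G < lefschetzGroupC Ψ G ∧
        4 * finrank ℚ (centerField Ψ hX) ≤ finrank ℂ E) ∨
      (IsAlbertTypeIV (centerField Ψ hX) (endAlgRat Ψ) (rosatiEnd Ψ hη.1 hη.2.2 hG) ∧
        finrank ℚ (endAlgRat Ψ) * finrank ℚ (lefschetzLieRat Ψ G) = 2 * finrank ℂ E ^ 2 ∧
        ¬ LieAlgebra.IsSemisimple ℚ ↥(lefschetzLieRat Ψ G) ∧ lefschetzIdentityC Ψ G = lefschetzGroupC Ψ G) := by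
  rcases h with h | h | h | h
  · exact Or.inl ⟨h, hX.milneSummaryTable_of_isAlbertTypeI hη hG h⟩
  · exact Or.inr (Or.inl ⟨h, hX.milneSummaryTable_of_isAlbertTypeII hη hG h⟩)
  · exact Or.inr (Or.inr (Or.inl ⟨h, hX.milneSummaryTable_of_isAlbertTypeIII hη hG h⟩))
  · exact Or.inr (Or.inr (Or.inr ⟨h, hX.milneSummaryTable_of_isAlbertTypeIV hη hG h⟩))

/-! ## §3 The whole table for `g ≤ 7`, unconditionally -/

/-- **MILNE'S SUMMARY TABLE FOR EVERY SIMPLE POLARISED COMPLEX TORUS OF DIMENSION `g ≤ 7`** — `X` is of Albert type I, II, III or IV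
(Albert's theorem for `g ≤ 7`, tree) and satisfies that row: (I) `e·dim Lie S = 2g² + eg`, semisimple, connected; (II) `2e·dim Lie S = g² + eg`,
semisimple, connected; (III) `2e·dim Lie S + eg = g²`, semisimple, NOT connected, `4e ≤ g` (so `e = 1`, `g ∈ {4, 6}`); (IV)
`[End_ℚ(X):ℚ]·dim Lie S = 2g²`, NOT semisimple, connected. [cite: Milne1999LefschetzClasses, §2 Summary table p. 652]
[cite: Lange2023AbelianVarietiesComplex, §2.6.1 Proposition (first column: «follow from Theorems 2.6.5 and 2.6.8»)] [cite: MumfordAV1970, §21 Thm. 2] -/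
theorem IsSimple.milneSummaryTable_of_finrank_le_seven (hX : IsSimple Ψ) (hη : IsRiemannForm Ψ η)
    (hG : G.map (Rat.cast : ℚ → ℝ) = latticeGram Ψ η) (hg : finrank ℂ E ≤ 7) :
    (IsAlbertTypeI (centerField Ψ hX) (endAlgRat Ψ) (rosatiEnd Ψ hη.1 hη.2.2 hG) ∧
        finrank ℚ (centerField Ψ hX) * finrank ℚ (lefschetzLieRat Ψ G) = 2 * finrank ℂ E ^ 2 + finrank ℚ (centerField Ψ hX) * finrank ℂ E ∧
        LieAlgebra.IsSemisimple ℚ ↥(lefschetzLieRat Ψ G) ∧ lefschetzIdentityC Ψ G = lefschetzGroupC Ψ G) ∨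
      (IsAlbertTypeII (centerField Ψ hX) (endAlgRat Ψ) (rosatiEnd Ψ hη.1 hη.2.2 hG) ∧
        2 * (finrank ℚ (centerField Ψ hX) * finrank ℚ (lefschetzLieRat Ψ G)) = finrank ℂ E ^ 2 + finrank ℚ (centerField Ψ hX) * finrank ℂ E ∧
        LieAlgebra.IsSemisimple ℚ ↥(lefschetzLieRat Ψ G) ∧ lefschetzIdentityC Ψ G = lefschetzGroupC Ψ G) ∨
      (IsAlbertTypeIII (centerField Ψ hX) (endAlgRat Ψ) (rosatiEnd Ψ hη.1 hη.2.2 hG) ∧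
        2 * (finrank ℚ (centerField Ψ hX) * finrank ℚ (lefschetzLieRat Ψ G)) + finrank ℚ (centerField Ψ hX) * finrank ℂ E = finrank ℂ E ^ 2 ∧
        LieAlgebra.IsSemisimple ℚ ↥(lefschetzLieRat Ψ G) ∧ lefschetzIdentityC Ψ G < lefschetzGroupC Ψ G ∧
        4 * finrank ℚ (centerField Ψ hX) ≤ finrank ℂ E) ∨
      (IsAlbertTypeIV (centerField Ψ hX) (endAlgRat Ψ) (rosatiEnd Ψ hη.1 hη.2.2 hG) ∧
        finrank ℚ (endAlgRat Ψ) * finrank ℚ (lefschetzLieRat Ψ G) = 2 * finrank ℂ E ^ 2 ∧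
        ¬ LieAlgebra.IsSemisimple ℚ ↥(lefschetzLieRat Ψ G) ∧ lefschetzIdentityC Ψ G = lefschetzGroupC Ψ G) :=
  hX.milneSummaryTable_of_isAlbertType hη hG (hX.isAlbertType_of_finrank_le_seven hη hG hg)

/-- `g ≤ 7`, the «Semisimple» column read backwards: `Lie S(X)` is NOT semisimple iff `X` is of Albert type IV (for every `g` this is
✔ g60-#1 `IsSimple.isSemisimple_lefschetzLieRat_iff_not_isAlbertTypeIV`; restated here next to its «Connected» twin).
[cite: Milne1999LefschetzClasses, §2 Summary table p. 652 (column «Semisimple»: No only in row IV)] -/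
theorem IsSimple.not_isSemisimple_lefschetzLieRat_iff_isAlbertTypeIV (hX : IsSimple Ψ) (hη : IsRiemannForm Ψ η)
    (hG : G.map (Rat.cast : ℚ → ℝ) = latticeGram Ψ η) :
    ¬ LieAlgebra.IsSemisimple ℚ ↥(lefschetzLieRat Ψ G) ↔ IsAlbertTypeIV (centerField Ψ hX) (endAlgRat Ψ) (rosatiEnd Ψ hη.1 hη.2.2 hG) := by
  rw [hX.isSemisimple_lefschetzLieRat_iff_not_isAlbertTypeIV hη hG, not_not]

/-- `g ≤ 7`, the «Connected» column read backwards: `Lf(X)(ℂ) ≠ S(X)(ℂ)` iff `X` is of Albert type III.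
[cite: Milne1999LefschetzClasses, §2 Summary table p. 652 (column «Connected»: No only in row III) and Remark 4.9] -/
theorem IsSimple.lefschetzIdentityC_ne_lefschetzGroupC_iff_isAlbertTypeIII_of_finrank_le_seven (hX : IsSimple Ψ)
    (hη : IsRiemannForm Ψ η) (hG : G.map (Rat.cast : ℚ → ℝ) = latticeGram Ψ η) (hg : finrank ℂ E ≤ 7) :
    lefschetzIdentityC Ψ G ≠ lefschetzGroupC Ψ G ↔ IsAlbertTypeIII (centerField Ψ hX) (endAlgRat Ψ) (rosatiEnd Ψ hη.1 hη.2.2 hG) := by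
  rw [Ne, hX.lefschetzIdentityC_eq_lefschetzGroupC_iff_not_isAlbertTypeIII' hη hG hg, not_not]

/-- `g ≤ 7`: «Semisimple ∧ Connected» iff type I or II (the two `Sp` rows). [cite: Milne1999LefschetzClasses, §2 Summary table p. 652 (rows I, II: «Yes ∣ Yes»)] -/
theorem IsSimple.isSemisimple_lefschetzLieRat_and_lefschetzIdentityC_eq_iff_of_finrank_le_seven (hX : IsSimple Ψ)
    (hη : IsRiemannForm Ψ η) (hG : G.map (Rat.cast : ℚ → ℝ) = latticeGram Ψ η) (hg : finrank ℂ E ≤ 7) :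
    (LieAlgebra.IsSemisimple ℚ ↥(lefschetzLieRat Ψ G) ∧ lefschetzIdentityC Ψ G = lefschetzGroupC Ψ G) ↔
      IsAlbertTypeI (centerField Ψ hX) (endAlgRat Ψ) (rosatiEnd Ψ hη.1 hη.2.2 hG) ∨
        IsAlbertTypeII (centerField Ψ hX) (endAlgRat Ψ) (rosatiEnd Ψ hη.1 hη.2.2 hG) := by
  have h4 := hX.isAlbertType_of_finrank_le_seven hη hG hg
  rw [hX.isSemisimple_lefschetzLieRat_and_lefschetzIdentityC_eq_iff hη hG h4]
  haveI : Nontrivial (endAlgRat Ψ) := ⟨⟨0, 1, fun h ↦ zero_ne_one (congrArg Subtype.val h)⟩⟩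
  constructor
  · rintro ⟨hIV, hIII⟩
    rcases h4 with h | h | h | h
    · exact Or.inl h
    · exact Or.inr h
    · exact absurd h hIII
    · exact absurd h hIV
  · rintro (h | h)
    · exact ⟨h.not_isAlbertTypeIV, h.not_isAlbertTypeIII⟩
    · exact ⟨h.not_isAlbertTypeIV, h.not_isAlbertTypeIII⟩

end SummaryTable

end ComplexTorus

end Literature.Geometry.Kaehler

end
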